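import Summits.QuantumFields.BalabanUV.Beta.FP.PerfectTelescopingBottomFinite
import Summits.QuantumFields.BalabanUV.Beta.FP.PerfectTelescopingHolds

/-!
# `BalabanUV.Beta.FP.PerfectTelescopingBottom` — road «FP» for binder row D1, sub-row **MS-1-BOT (ii)** (owner d1-p3 gen 12, `LEAVES-FP.md` l.546;
# design `JETS-JM-DESIGN.md` v2 §4 (a)(b)): **THE BOTTOM PAIR TELESCOPING OF THE PERFECT RESOLVENTS — «Γ_{Lc^{m+1}} = Γ_{Lc} + ℋ_{Lc}·lift_{Lc}(Γ_{Lc^m})·ℋ_{Lc}ᵀ»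
# ON THE TRANSVERSE SLICE, UNCONDITIONAL** (`d + 1 = 4`, `Lc ≥ 2`, `m ≥ 1`): the new step at the BOTTOM, the shape of the END's `hSDF` split

HONEST DEPENDENCY (page 1, mandatory): continuum YM on T⁴ ⇐ BetaPertH ∧ nine spine estimates (0/9 proved); BetaPertH ⇐ (D1) ∧ (D4) ∧ CAP+tail;
G-an2-4 gates asym, D1 and NE2/3/4.  HONEST FRAMING (cell contract, verbatim): «discharging `BetaPertH` makes Bałaban's UV stability UNCONDITIONAL —
a real constructive-QFT result; it is NOT the continuum limit and NOT the Clay problem.»  THIS MODULE is [folklore] bookkeeping + ONE Tannery passage to the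
limit (the tree's generic `PerfectTelescopingLimit.tendsto_comp_liftW_comp`) over this lineage's finite layer `PerfectTelescopingBottomFinite.kTot_pair_telescoping_bottom_step`,
the unit calculus `PerfectTelescopingFiniteUnits.pair_unitK_ff` ∕ `comp_unitK_liftW_unitK_ff` ∕ `unitScalar_adopted`, and the road's UNCONDITIONAL K-side rows
`GAN24.RealRateKMHolds.tendsto_KTot_KPerf_holds`, `GAN24.KSlotJMHolds.kSlotJM_holds` BY NAME.  No `def`, no `def … : Prop`, nothing cited, nothing of
Bałaban's asserted, 0 sorry.  0∕4 row-D1 binders; NOT (SDF), NOT (ASYMP), NOT D1, NOT `BetaPertH`, NOT continuum, NOT Clay.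

ABSOLUTE RULE (cell charter, verbatim): «No internally-minted statement may enter as a cited fact. Every hypothesis is either kernel-proved in
this package or a verbatim quotation of a PUBLISHED theorem with page reference. The manuscript(s) under audit are NOT citable for their own
disputed steps — they are the thing under adjudication; programme-internal (2001/route/tribunal) claims are never citable.»

WHY (JETS-JM v2 §4 (a)–(b)).  The END `RoadLeftLiteralStraight.d1Drift_JsB12Sym_of_sliceLedger_straight` displays `hSDF` with the NEW step at the
BOTTOM (`RP m` transports the ONE-step kernel through the m-fold perfect columns), while the K-bricks of record (`PerfectTelescopingHolds`) are TOP.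
This file is the BOTTOM brick: for co-closed finitely supported `G, G′`,
`⟨G, [KPerf (m+1)]_ff G′⟩ = ⟨G, ([KPerf 1] − (Lc²)⁻¹·[KPerf 1 ∘ liftW Lc true true (KPerf m) ∘ KPerf 1])_ff G′⟩` — the perfect ONE-step resolvent's
covariance plus its minimisers sandwiching the perfect `m`-fold resolvent lifted onto `Lc·ℤ⁴` (sign: the `(inr, inl)` block carries `ℋ♭ = −ℋᵀ`, as in
the TOP theorem).  Route (the owner's preferred one): an5's two-level decomposition at `(M, L) = (Lc^(j+1), Lc^m)` at finite `j` (the finite layer),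
adopted units (composite scalar `((Lc^j)^(d+2))²∕(sm j·sf (j+1))² = (Lc²)⁻¹`, j-FREE), `j → ∞` by Tannery with the three families
`U_j KTot_{j,m+1} → KPerf (m+1)`, `U_j KTot_{j,1} → KPerf 1`, `U_{j+1} KTot_{j+1,m} → KPerf m` (the last by the index shift `limMKerOf_add`, as in the owner's
`PerfectColumnSemigroup`); with (i) «ℋ_{Lc^{m+1}} = ℋ_{Lc} ∘ lift_{Lc}(ℋ_{Lc^m})» this is the TOP ↔ BOTTOM bridge of §4 (b) as a theorem rather than a derivation.

CONTENT.
* §1 [folklore] `kTot_pair_telescoping_bottom_units` (any unit sequences), `kTot_pair_telescoping_bottom_adopted` (`sf j = Lc^j`, `sm j = Lc^{j(d+1)}`: scalar `(Lc·Lc)⁻¹`).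
* §2 [folklore] `kPerf_pair_telescoping_bottom` — the limit under DISPLAYED convergence ∕ uniform-decay rows (every `d`, `Lc ≥ 1`).
* §3 [our proof] **`kPerf_pair_telescoping_bottom_holds`** — `d + 1 = 4`, `Lc ≥ 2`, `m ≥ 1`: all rows supplied, UNCONDITIONAL.
NOT HERE (honest): the trace expansion N2a at the perfect objects, (SDF)∞, the jets' fixed-point equations (JETS-JM v2 §4 (c)–(e)).
Unit `b2b-balaban-gan24-formalise-leaf-05` (gen 42; author of MS-1-FIN gen 33), road «FP» sub-row MS-1-BOT (ii) (INTENT journal 2026-08-21 l.31218, STATEMENT l.31324).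
-/

noncomputable section

namespace Summit.QuantumFields.BalabanUV.Beta.FP.PerfectTelescopingBottom

open Finset Filter Topology
open scoped BigOperators
open Literature.MathematicalPhysics.QuantumFieldTheory.Balaban1983to89
open Literature.MathematicalPhysics.QuantumFieldTheory.Balaban1983to89.Beta
open AffineAveraging (Form1 codiff₁)
open ExpKernelCalculus (MKer Decays comp)
open OneStepResolventKernel (Fib KInv)
open OneStepKernelFamily (dec KInvStep)
open InterLevelTransport (liftW slotW slotW_true)
open ResolventComposition (slot_true)
open ResolventCompositionStepB (tsum_pair_eq_sum exists_support_finset)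
open HessKerDressedLimit (limMKerOf limMKerOf_apply)
open Summit.QuantumFields.BalabanUV.Beta.HessKerDressedUnits (unitK unitK_apply legScale legScale_inl legScale_inr)
open Summit.QuantumFields.BalabanUV.Beta.GAN24.CombesThomas (sfStep smStep)
open Summit.QuantumFields.BalabanUV.Beta.GAN24.RealRateKMHolds (tendsto_KTot_KPerf_holds)
open Summit.QuantumFields.BalabanUV.Beta.GAN24.KSlotJMHolds (kSlotJM_holds)
open Summit.QuantumFields.BalabanUV.Beta.FP.PerfectObjects (KTot)
open Summit.QuantumFields.BalabanUV.Beta.FP.PerfectObjectsT (KPerf)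
open Summit.QuantumFields.BalabanUV.Beta.FP.StationarityK (limMKerOf_add)
open Summit.QuantumFields.BalabanUV.Beta.FP.PerfectTelescopingFiniteUnits (pair_unitK_ff comp_unitK_liftW_unitK_ff unitScalar_adopted)
open Summit.QuantumFields.BalabanUV.Beta.FP.PerfectTelescopingLimit (tendsto_limMKerOf_apply tendsto_comp_liftW_comp)
open Summit.QuantumFields.BalabanUV.Beta.FP.PerfectTelescopingHolds (decays_le_const)
open Summit.QuantumFields.BalabanUV.Beta.FP.PerfectTelescopingBottomFinite (kTot_pair_telescoping_bottom_step)

variable {d : ℕ} (Lc : ℕ) [NeZero Lc]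

/-! ## §1 Units -/

/-- [folklore] **THE BOTTOM PAIR TELESCOPING IN UNITS** (any unit sequences `sf, sm` with `sm j ≠ 0`, `sf (j+1) ≠ 0`; `U_i := unitK (sf i) (sm i)`):
`⟨G, [U_j KTot_{j,m+1}]_ff G′⟩ = ⟨G, ([U_j KTot_{j,1}] − c_j·[U_j KTot_{j,1} ∘ liftW Lc true true (U_{j+1} KTot_{j+1,m}) ∘ U_j KTot_{j,1}])_ff G′⟩`,
`c_j = ((Lc^j)^(d+2))² ∕ (sm j · sf (j+1))²` — the finite layer × `(sf j)²`, units pulled through. -/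
theorem kTot_pair_telescoping_bottom_units (sf sm : ℕ → ℝ) (j m : ℕ) (hsm : sm j ≠ 0) (hsf' : sf (j + 1) ≠ 0) (G G' : Form1 (d + 1) ℝ)
    (hG : ∀ κ, (Function.support (G κ)).Finite) (hG' : ∀ κ, (Function.support (G' κ)).Finite)
    (hcoG : codiff₁ G = 0) (hcoG' : codiff₁ G' = 0) :
    (∑' x', ∑' y', ∑ κ, ∑ l, G κ x' * unitK (sf j) (sm j) (KTot (d := d) (Lc ^ (j + 1 + m)) (Lc ^ j)) x' y' (Sum.inl κ) (Sum.inl l) * G' l y')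
      = ∑' x', ∑' y', ∑ κ, ∑ l, G κ x' *
          (unitK (sf j) (sm j) (KTot (d := d) (Lc ^ (j + 1)) (Lc ^ j)) x' y' (Sum.inl κ) (Sum.inl l)
            - ((((Lc ^ j : ℕ) : ℝ)) ^ (d + 2) * (((Lc ^ j : ℕ) : ℝ)) ^ (d + 2)) / ((sm j * sf (j + 1)) * (sm j * sf (j + 1)))
              * comp (unitK (sf j) (sm j) (KTot (d := d) (Lc ^ (j + 1)) (Lc ^ j)))
                  (comp (liftW Lc true true (unitK (sf (j + 1)) (sm (j + 1)) (KTot (d := d) (Lc ^ (j + 1 + m)) (Lc ^ (j + 1)))))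
                    (unitK (sf j) (sm j) (KTot (d := d) (Lc ^ (j + 1)) (Lc ^ j))))
                  x' y' (Sum.inl κ) (Sum.inl l)) * G' l y' := by
  obtain ⟨s, hs⟩ := exists_support_finset G hG
  obtain ⟨s', hs'⟩ := exists_support_finset G' hG'
  have hfin := kTot_pair_telescoping_bottom_step (d := d) Lc j m G G' hG hG' hcoG hcoG'
  rw [tsum_pair_eq_sum G G' s s' hs hs', tsum_pair_eq_sum G G' s s' hs hs'] at hfin
  rw [tsum_pair_eq_sum G G' s s' hs hs', tsum_pair_eq_sum G G' s s' hs hs']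
  simp only [comp_unitK_liftW_unitK_ff, unitK_apply, legScale_inl]
  have eL : ∀ (x' y' : Fin (d + 1) → ℤ) (κ l : Fin (d + 1)),
      G κ x' * (sf j * KTot (d := d) (Lc ^ (j + 1 + m)) (Lc ^ j) x' y' (Sum.inl κ) (Sum.inl l) * sf j) * G' l y'
        = sf j * sf j * (G κ x' * KTot (d := d) (Lc ^ (j + 1 + m)) (Lc ^ j) x' y' (Sum.inl κ) (Sum.inl l) * G' l y') := by
    intro x' y' κ l; ring
  have eR : ∀ (x' y' : Fin (d + 1) → ℤ) (κ l : Fin (d + 1)),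
      G κ x' * (sf j * KTot (d := d) (Lc ^ (j + 1)) (Lc ^ j) x' y' (Sum.inl κ) (Sum.inl l) * sf j
          - ((((Lc ^ j : ℕ) : ℝ)) ^ (d + 2) * (((Lc ^ j : ℕ) : ℝ)) ^ (d + 2)) / ((sm j * sf (j + 1)) * (sm j * sf (j + 1)))
            * ((sf j * sm j) * (sf j * sm j) * (sf (j + 1) * sf (j + 1))
              * comp (KTot (d := d) (Lc ^ (j + 1)) (Lc ^ j))
                  (comp (liftW Lc true true (KTot (d := d) (Lc ^ (j + 1 + m)) (Lc ^ (j + 1)))) (KTot (d := d) (Lc ^ (j + 1)) (Lc ^ j)))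
                  x' y' (Sum.inl κ) (Sum.inl l))) * G' l y'
        = sf j * sf j * (G κ x' * (KTot (d := d) (Lc ^ (j + 1)) (Lc ^ j) x' y' (Sum.inl κ) (Sum.inl l)
            - ((((Lc ^ j : ℕ) : ℝ)) ^ (d + 2) * (((Lc ^ j : ℕ) : ℝ)) ^ (d + 2))
              * comp (KTot (d := d) (Lc ^ (j + 1)) (Lc ^ j))
                  (comp (liftW Lc true true (KTot (d := d) (Lc ^ (j + 1 + m)) (Lc ^ (j + 1)))) (KTot (d := d) (Lc ^ (j + 1)) (Lc ^ j)))
                  x' y' (Sum.inl κ) (Sum.inl l)) * G' l y') := by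
    intro x' y' κ l
    have hQ : (sm j * sf (j + 1)) * (sm j * sf (j + 1)) ≠ 0 := mul_ne_zero (mul_ne_zero hsm hsf') (mul_ne_zero hsm hsf')
    have key : ((((Lc ^ j : ℕ) : ℝ)) ^ (d + 2) * (((Lc ^ j : ℕ) : ℝ)) ^ (d + 2)) / ((sm j * sf (j + 1)) * (sm j * sf (j + 1)))
        * ((sf j * sm j) * (sf j * sm j) * (sf (j + 1) * sf (j + 1))
          * comp (KTot (d := d) (Lc ^ (j + 1)) (Lc ^ j))
              (comp (liftW Lc true true (KTot (d := d) (Lc ^ (j + 1 + m)) (Lc ^ (j + 1)))) (KTot (d := d) (Lc ^ (j + 1)) (Lc ^ j)))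
              x' y' (Sum.inl κ) (Sum.inl l))
        = sf j * sf j * ((((Lc ^ j : ℕ) : ℝ)) ^ (d + 2) * (((Lc ^ j : ℕ) : ℝ)) ^ (d + 2)
          * comp (KTot (d := d) (Lc ^ (j + 1)) (Lc ^ j))
              (comp (liftW Lc true true (KTot (d := d) (Lc ^ (j + 1 + m)) (Lc ^ (j + 1)))) (KTot (d := d) (Lc ^ (j + 1)) (Lc ^ j)))
              x' y' (Sum.inl κ) (Sum.inl l)) := by
      rw [div_mul_eq_mul_div, div_eq_iff hQ]
      ring
    rw [key]
    ring
  simp only [eL, eR, ← Finset.mul_sum]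
  rw [hfin]

/-- [folklore] **THE BOTTOM PAIR TELESCOPING IN THE ADOPTED UNITS** (`sf j = Lc^j`, `sm j = Lc^{j(d+1)}`): the composite's scalar is `(Lc·Lc)⁻¹`, INDEPENDENT of `j`. -/
theorem kTot_pair_telescoping_bottom_adopted (hLc : 1 ≤ Lc) (j m : ℕ) (G G' : Form1 (d + 1) ℝ)
    (hG : ∀ κ, (Function.support (G κ)).Finite) (hG' : ∀ κ, (Function.support (G' κ)).Finite)
    (hcoG : codiff₁ G = 0) (hcoG' : codiff₁ G' = 0) :
    (∑' x', ∑' y', ∑ κ, ∑ l, G κ x'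
        * unitK ((Lc : ℝ) ^ j) ((Lc : ℝ) ^ (j * (d + 1))) (KTot (d := d) (Lc ^ (j + 1 + m)) (Lc ^ j)) x' y' (Sum.inl κ) (Sum.inl l) * G' l y')
      = ∑' x', ∑' y', ∑ κ, ∑ l, G κ x' *
          (unitK ((Lc : ℝ) ^ j) ((Lc : ℝ) ^ (j * (d + 1))) (KTot (d := d) (Lc ^ (j + 1)) (Lc ^ j)) x' y' (Sum.inl κ) (Sum.inl l)
            - (((Lc : ℝ)) * ((Lc : ℝ)))⁻¹
              * comp (unitK ((Lc : ℝ) ^ j) ((Lc : ℝ) ^ (j * (d + 1))) (KTot (d := d) (Lc ^ (j + 1)) (Lc ^ j)))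
                  (comp (liftW Lc true true
                      (unitK ((Lc : ℝ) ^ (j + 1)) ((Lc : ℝ) ^ ((j + 1) * (d + 1))) (KTot (d := d) (Lc ^ (j + 1 + m)) (Lc ^ (j + 1)))))
                    (unitK ((Lc : ℝ) ^ j) ((Lc : ℝ) ^ (j * (d + 1))) (KTot (d := d) (Lc ^ (j + 1)) (Lc ^ j))))
                  x' y' (Sum.inl κ) (Sum.inl l)) * G' l y' := by
  have hL : (Lc : ℝ) ≠ 0 := by exact_mod_cast (show Lc ≠ 0 by omega)
  have h := kTot_pair_telescoping_bottom_units (d := d) Lc (fun i => (Lc : ℝ) ^ i) (fun i => (Lc : ℝ) ^ (i * (d + 1))) j m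
    (pow_ne_zero _ hL) (pow_ne_zero _ hL) G G' hG hG' hcoG hcoG'
  rw [unitScalar_adopted Lc hLc j 1, pow_one] at h
  exact h

/-! ## §2 The limit `j → ∞` under displayed rows -/

/-- [folklore] **THE BOTTOM PAIR TELESCOPING AT THE LIMIT, from displayed rows** (every `d`, `Lc ≥ 1`; `U_j := unitK (Lc^j) (Lc^{j(d+1)})`).  ASSUME
(displayed, asserted nowhere): every entry of the rescaled (j, m+1)-, (j, 1)- and (j, m)-families converges as `j → ∞`; the rescaled (j, 1)-family decays
`j`-uniformly; the rescaled (j, m)-family is `j`-uniformly bounded.  THEN for all finitely supported CO-CLOSED `G, G′`,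
`⟨G, [KPerf (m+1)]_ff G′⟩ = ⟨G, ([KPerf 1] − (Lc·Lc)⁻¹·[KPerf 1 ∘ liftW Lc true true (KPerf m) ∘ KPerf 1])_ff G′⟩`. -/
theorem kPerf_pair_telescoping_bottom (hLc : 1 ≤ Lc) (m : ℕ) {CB δB CS : ℝ} (hδB : 0 < δB)
    (hconvA : ∀ x y a b, ∃ L, Tendsto (fun j => unitK ((Lc : ℝ) ^ j) ((Lc : ℝ) ^ (j * (d + 1)))
      (KTot (d := d) (Lc ^ (j + (m + 1))) (Lc ^ j)) x y a b) atTop (𝓝 L))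
    (hconvB : ∀ x y a b, ∃ L, Tendsto (fun j => unitK ((Lc : ℝ) ^ j) ((Lc : ℝ) ^ (j * (d + 1)))
      (KTot (d := d) (Lc ^ (j + 1)) (Lc ^ j)) x y a b) atTop (𝓝 L))
    (hconvC : ∀ x y a b, ∃ L, Tendsto (fun j => unitK ((Lc : ℝ) ^ j) ((Lc : ℝ) ^ (j * (d + 1)))
      (KTot (d := d) (Lc ^ (j + m)) (Lc ^ j)) x y a b) atTop (𝓝 L))
    (hBd : ∀ j, Decays (unitK ((Lc : ℝ) ^ j) ((Lc : ℝ) ^ (j * (d + 1))) (KTot (d := d) (Lc ^ (j + 1)) (Lc ^ j))) CB δB)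
    (hCb : ∀ j z w (a b : Fib d), |unitK ((Lc : ℝ) ^ j) ((Lc : ℝ) ^ (j * (d + 1))) (KTot (d := d) (Lc ^ (j + m)) (Lc ^ j)) z w a b| ≤ CS)
    (G G' : Form1 (d + 1) ℝ) (hG : ∀ κ, (Function.support (G κ)).Finite) (hG' : ∀ κ, (Function.support (G' κ)).Finite)
    (hcoG : codiff₁ G = 0) (hcoG' : codiff₁ G' = 0) :
    (∑' x', ∑' y', ∑ κ, ∑ l, G κ x'
        * KPerf (d := d) Lc (fun j => (Lc : ℝ) ^ j) (fun j => (Lc : ℝ) ^ (j * (d + 1))) (m + 1) x' y' (Sum.inl κ) (Sum.inl l) * G' l y')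
      = ∑' x', ∑' y', ∑ κ, ∑ l, G κ x' *
          (KPerf (d := d) Lc (fun j => (Lc : ℝ) ^ j) (fun j => (Lc : ℝ) ^ (j * (d + 1))) 1 x' y' (Sum.inl κ) (Sum.inl l)
            - (((Lc : ℝ)) * ((Lc : ℝ)))⁻¹
              * comp (KPerf (d := d) Lc (fun j => (Lc : ℝ) ^ j) (fun j => (Lc : ℝ) ^ (j * (d + 1))) 1)
                  (comp (liftW Lc true true (KPerf (d := d) Lc (fun j => (Lc : ℝ) ^ j) (fun j => (Lc : ℝ) ^ (j * (d + 1))) m))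
                    (KPerf (d := d) Lc (fun j => (Lc : ℝ) ^ j) (fun j => (Lc : ℝ) ^ (j * (d + 1))) 1))
                  x' y' (Sum.inl κ) (Sum.inl l)) * G' l y' := by
  obtain ⟨s, hs⟩ := exists_support_finset G hG
  obtain ⟨s', hs'⟩ := exists_support_finset G' hG'
  -- the three rescaled families and their constructed limits
  set A : ℕ → MKer (d + 1) (Fib d) := fun j => unitK ((Lc : ℝ) ^ j) ((Lc : ℝ) ^ (j * (d + 1)))
    (KTot (d := d) (Lc ^ (j + (m + 1))) (Lc ^ j)) with hA
  set B : ℕ → MKer (d + 1) (Fib d) := fun j => unitK ((Lc : ℝ) ^ j) ((Lc : ℝ) ^ (j * (d + 1)))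
    (KTot (d := d) (Lc ^ (j + 1)) (Lc ^ j)) with hB
  set C : ℕ → MKer (d + 1) (Fib d) := fun j => unitK ((Lc : ℝ) ^ j) ((Lc : ℝ) ^ (j * (d + 1)))
    (KTot (d := d) (Lc ^ (j + m)) (Lc ^ j)) with hC
  have hKA : KPerf (d := d) Lc (fun j => (Lc : ℝ) ^ j) (fun j => (Lc : ℝ) ^ (j * (d + 1))) (m + 1) = limMKerOf A := rfl
  have hKB : KPerf (d := d) Lc (fun j => (Lc : ℝ) ^ j) (fun j => (Lc : ℝ) ^ (j * (d + 1))) 1 = limMKerOf B := rfl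
  have hKC : KPerf (d := d) Lc (fun j => (Lc : ℝ) ^ j) (fun j => (Lc : ℝ) ^ (j * (d + 1))) m = limMKerOf C := rfl
  have hKC' : limMKerOf (fun j => C (j + 1)) = limMKerOf C := limMKerOf_add C 1
  -- the shifted middle family IS `U_{j+1} KTot_{j+1,m}` with the finite layer's index spelling
  have hC1 : ∀ j, C (j + 1) = unitK ((Lc : ℝ) ^ (j + 1)) ((Lc : ℝ) ^ ((j + 1) * (d + 1))) (KTot (d := d) (Lc ^ (j + 1 + m)) (Lc ^ (j + 1))) :=
    fun j => rfl
  have hA1 : ∀ j, A j = unitK ((Lc : ℝ) ^ j) ((Lc : ℝ) ^ (j * (d + 1))) (KTot (d := d) (Lc ^ (j + 1 + m)) (Lc ^ j)) := by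
    intro j; show unitK _ _ (KTot (d := d) (Lc ^ (j + (m + 1))) (Lc ^ j)) = _; rw [show j + (m + 1) = j + 1 + m by omega]
  -- entrywise convergence to the constructed limits
  have tA : ∀ x y a b, Tendsto (fun j => A j x y a b) atTop (𝓝 (limMKerOf A x y a b)) :=
    fun x y a b => tendsto_limMKerOf_apply x y a b (hconvA x y a b)
  have tB : ∀ x y a b, Tendsto (fun j => B j x y a b) atTop (𝓝 (limMKerOf B x y a b)) :=
    fun x y a b => tendsto_limMKerOf_apply x y a b (hconvB x y a b)
  have tC : ∀ x y a b, Tendsto (fun j => C (j + 1) x y a b) atTop (𝓝 (limMKerOf C x y a b)) := by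
    intro x y a b
    rw [← hKC']
    refine tendsto_limMKerOf_apply (K := fun j => C (j + 1)) x y a b ?_
    obtain ⟨L, hL⟩ := hconvC x y a b
    exact ⟨L, hL.comp (tendsto_add_atTop_nat 1)⟩
  -- the finite-level identity, as finite sums, for every `j`
  have hfin : ∀ j : ℕ, ∑ x' ∈ s, ∑ y' ∈ s', ∑ κ, ∑ l, G κ x' * A j x' y' (Sum.inl κ) (Sum.inl l) * G' l y'
      = ∑ x' ∈ s, ∑ y' ∈ s', ∑ κ, ∑ l, G κ x' * (B j x' y' (Sum.inl κ) (Sum.inl l)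
          - (((Lc : ℝ)) * ((Lc : ℝ)))⁻¹ * comp (B j) (comp (liftW Lc true true (C (j + 1))) (B j)) x' y' (Sum.inl κ) (Sum.inl l))
          * G' l y' := by
    intro j
    have h := kTot_pair_telescoping_bottom_adopted (d := d) Lc hLc j m G G' hG hG' hcoG hcoG'
    rw [tsum_pair_eq_sum G G' s s' hs hs', tsum_pair_eq_sum G G' s s' hs hs'] at h
    simp only [hA1, hC1]
    exact h
  -- pass to the limit on both sides
  rw [hKA, hKB, hKC, tsum_pair_eq_sum G G' s s' hs hs', tsum_pair_eq_sum G G' s s' hs hs']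
  have limL : Tendsto (fun j => ∑ x' ∈ s, ∑ y' ∈ s', ∑ κ, ∑ l, G κ x' * A j x' y' (Sum.inl κ) (Sum.inl l) * G' l y') atTop
      (𝓝 (∑ x' ∈ s, ∑ y' ∈ s', ∑ κ, ∑ l, G κ x' * limMKerOf A x' y' (Sum.inl κ) (Sum.inl l) * G' l y')) :=
    tendsto_finsetSum _ fun x' _ => tendsto_finsetSum _ fun y' _ => tendsto_finsetSum _ fun κ _ =>
      tendsto_finsetSum _ fun l _ => ((tA _ _ _ _).const_mul _).mul_const _
  have limR : Tendsto (fun j => ∑ x' ∈ s, ∑ y' ∈ s', ∑ κ, ∑ l, G κ x' * (B j x' y' (Sum.inl κ) (Sum.inl l)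
          - (((Lc : ℝ)) * ((Lc : ℝ)))⁻¹ * comp (B j) (comp (liftW Lc true true (C (j + 1))) (B j)) x' y' (Sum.inl κ) (Sum.inl l))
          * G' l y') atTop
      (𝓝 (∑ x' ∈ s, ∑ y' ∈ s', ∑ κ, ∑ l, G κ x' * (limMKerOf B x' y' (Sum.inl κ) (Sum.inl l)
          - (((Lc : ℝ)) * ((Lc : ℝ)))⁻¹
            * comp (limMKerOf B) (comp (liftW Lc true true (limMKerOf C)) (limMKerOf B)) x' y' (Sum.inl κ) (Sum.inl l)) * G' l y')) := by
    refine tendsto_finsetSum _ fun x' _ => tendsto_finsetSum _ fun y' _ => tendsto_finsetSum _ fun κ _ =>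
      tendsto_finsetSum _ fun l _ => (((tB _ _ _ _).sub ((tendsto_comp_liftW_comp Lc (B := B) (S := fun j => C (j + 1))
        tB (fun z w μ ν => tC z w _ _) hBd hδB (fun j z w μ ν => hCb (j + 1) z w _ _) x' y' κ l).const_mul _)).const_mul _).mul_const _
  exact tendsto_nhds_unique limL (by simpa only [hfin] using limR)

/-! ## §3 At the road's data: UNCONDITIONAL -/

/-- [our proof] **MS-1-BOT (ii) — THE BOTTOM PAIR TELESCOPING OF THE PERFECT RESOLVENTS, TRANSVERSE FORM, UNCONDITIONAL** (`d + 1 = 4`, `Lc ≥ 2`, `m ≥ 1`).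
For all finitely supported CO-CLOSED test 1-forms `G, G′`, with `KPerf … m := KPerf Lc (sfStep Lc) (smStep 3 Lc) m`:
`Σ'Σ'ΣΣ G κ x′ · [KPerf … (m+1)] x′ y′ (inl κ)(inl l) · G′ l y′
   = Σ'Σ'ΣΣ G κ x′ · ([KPerf … 1] x′ y′ (inl κ)(inl l) − (Lc·Lc)⁻¹ · [KPerf … 1 ∘ liftW Lc true true (KPerf … m) ∘ KPerf … 1] x′ y′ (inl κ)(inl l)) · G′ l y′`
— «Γ_{Lc^{m+1}} = Γ_{Lc} + ℋ_{Lc}·lift_{Lc}(Γ_{Lc^m})·ℋ_{Lc}ᵀ» (the `(inr, inl)` block carries `ℋ♭ = −ℋᵀ`), the new step at the BOTTOM, the END's `hSDF` shape: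
`kPerf_pair_telescoping_bottom` with ALL rows supplied by `RealRateKMHolds.tendsto_KTot_KPerf_holds` (three families) and `KSlotJMHolds.kSlotJM_holds` (at 1 and at m). -/
theorem kPerf_pair_telescoping_bottom_holds (hLc : 2 ≤ Lc) {m : ℕ} (hm : 1 ≤ m) (G G' : Form1 (3 + 1) ℝ)
    (hG : ∀ κ, (Function.support (G κ)).Finite) (hG' : ∀ κ, (Function.support (G' κ)).Finite)
    (hcoG : codiff₁ G = 0) (hcoG' : codiff₁ G' = 0) :
    (∑' x', ∑' y', ∑ κ, ∑ l, G κ x'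
        * KPerf (d := 3) Lc (sfStep Lc) (smStep 3 Lc) (m + 1) x' y' (Sum.inl κ) (Sum.inl l) * G' l y')
      = ∑' x', ∑' y', ∑ κ, ∑ l, G κ x' *
          (KPerf (d := 3) Lc (sfStep Lc) (smStep 3 Lc) 1 x' y' (Sum.inl κ) (Sum.inl l)
            - (((Lc : ℝ)) * ((Lc : ℝ)))⁻¹
              * comp (KPerf (d := 3) Lc (sfStep Lc) (smStep 3 Lc) 1)
                  (comp (liftW Lc true true (KPerf (d := 3) Lc (sfStep Lc) (smStep 3 Lc) m))
                    (KPerf (d := 3) Lc (sfStep Lc) (smStep 3 Lc) 1))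
                  x' y' (Sum.inl κ) (Sum.inl l)) * G' l y' := by
  obtain ⟨C1, δ1, _, _, hδ1, _, _, h1d, _⟩ := kSlotJM_holds (Lc := Lc) hLc (le_refl 1)
  obtain ⟨CB, δB, _, _, hδB, _, _, hBd, _⟩ := kSlotJM_holds (Lc := Lc) hLc hm
  have hsf : (sfStep Lc) = fun j => (Lc : ℝ) ^ j := rfl
  have hsm : (smStep 3 Lc) = fun j => (Lc : ℝ) ^ (j * (3 + 1)) := rfl
  rw [hsf, hsm]
  refine kPerf_pair_telescoping_bottom (d := 3) Lc (by omega) m (CB := C1) (δB := δ1) (CS := CB) hδ1 ?_ ?_ ?_ ?_ ?_ G G' hG hG' hcoG hcoG'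
  · intro x y a b
    exact ⟨_, tendsto_KTot_KPerf_holds hLc (m := m + 1) (by omega) x y a b⟩
  · intro x y a b
    exact ⟨_, tendsto_KTot_KPerf_holds hLc (m := 1) le_rfl x y a b⟩
  · intro x y a b
    exact ⟨_, tendsto_KTot_KPerf_holds hLc hm x y a b⟩
  · exact h1d
  · intro j z w a b
    exact decays_le_const (hBd j) hδB.le z w a b

end Summit.QuantumFields.BalabanUV.Beta.FP.PerfectTelescopingBottom

end
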